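import Summits.QuantumFields.BalabanUV.Beta.RemainderExplicitHistoryDiagonalRunEnvelope
import Summits.QuantumFields.BalabanUV.Beta.RemainderExplicitHistoryDiagonalMemoryZoneCubic
import Summits.QuantumFields.BalabanUV.Beta.RemainderExplicitHistoryDiagonalComparison

/-!
# RemainderExplicitHistoryDiagonalForwardStep — ROAD P3, ORDER-0 PROFILE FAMILY: THE FORWARD STEP OF THE MATCHED DISCREPANCY WITH THE
# PAST'S SURPLUS MATCHED AGAINST ITS OWN ECHO — at a position `j` whose past dominates (`d_i ≥ d_j`, `i < j`) the decrement of two pinned runs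
# (A: `K` steps, B: `K + 1` steps) of `β_{k+1} = b + Σ_{a≤k} ρ(a)·min(g_k, |g_k − g_{k−a}|)` satisfies
# `Θ_j·(d_j − d_{j+1}) ≥ (Θ_j E′_j − κ′_j U′_j) + W_j·(Θ_j − (K − j)κ′_j)` with `W_j ≥ 0` the surplus of the past gaps over their trial gaps,
# `κ′_j = ½[Σ_{i<j} ρ(j−i)((g^A_j)³ − (g^A_i)³) + ρ(j+1)(g^A_j)³]`, `U′_j = Σ_{l∈[j,K)} ρ(l+1)(g^A_l − g^B_0)`, `E′_j = ρ(j+1)(g^A_j − g^B_0)`,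
# `Θ_j = 1 − (K−j)·½Σ_{i<j} ρ(j−i)(g^A_i)³ − ½Σ_{i∈[j,K)} (W − R(i+1))(g^A_i)³ ∕ (1 − Wγ∕b)`; hence TWO SCALAR INEQUALITIES between run
# quantities — `(K − j)κ′_j ≤ Θ_j` and `κ′_j U′_j ≤ Θ_j E′_j` — at every position give exact monotonicity of `d` in the position EVERYWHERE, for
# every profile non-increasing on the positive ages (station S-d4p3-g55-1 «one forward induction», second file; the first file bounds `Θ_j` from
# below, the third discharges `κ′_j U′_j ≤ Θ_j E′_j` in closed form under `4Wγ ≤ b` and concludes)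

Cell `pub-balaban`, β-function sub-cell, BINDER row D4 «RemainderConst leaves for Bałaban's split» (`HOME/BINDER-OWNERS.md`; owner lineage
`b2b-balaban-beta-an4`; this file by co-owner #3 lineage `b2b-balaban-beta-d4-p3`, road P3 «the reduction road», generation 55, station
S-d4p3-g55-1, second file; imports the station's first file `RemainderExplicitHistoryDiagonalRunEnvelope` (hence `…EchoMonotone`), generation 54's
`RemainderExplicitHistoryDiagonalMemoryZoneCubic` (hence `…MemoryZone`) and generation 50's `RemainderExplicitHistoryDiagonalComparison`), β-FLOW TEAM duty (1);
FREEZE (0) honoured (def-free module in road P3's own `RemainderExplicit*` series; no leaf, no interface, no Literature file).  SOURCE OF THE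
SHAPES ONLY: [Balaban1987RG1] (0.20) p. 256, (0.31) and Thm 2 p. 259, §5 p. 298.  [folklore] real analysis about ONE explicit toy family (ours),
road P3's ORDER-0 PROFILE FAMILY (generation 44).
HONEST FRAMING: *"Discharging BetaPertH makes Bałaban's UV stability UNCONDITIONAL — a real constructive-QFT result; it is NOT the continuum
limit and NOT the Clay problem."*  THIS FILE DISCHARGES NOTHING OF THE KIND; nothing of Bałaban's (1.22) is asserted or constructed; row D4
class UNCHANGED (critical-path width 0; instance 0∕1; D4 DISCHARGE NO DATE); NOT B12 Thm 2, NOT BetaPertH, NOT continuum, NOT Clay.  HONEST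
DEPENDENCY: continuum YM on T⁴ ⇐ BetaPertH ∧ nine spine estimates (0/9 proved); BetaPertH ⇐ (D1) ∧ (D4) ∧ CAP+tail; G-an2-4 gates asym, D1
and NE2/3/4.  ABSOLUTE RULE: nothing is cited as a fact.  All letters NOT-IN-PRINT; `BetaFlowAsPrinted S` records a Markov β_n only.

THE IDEA (census item (i′) of generations 50–54: «`d_{j+1} ≤ d_j` for every non-increasing profile»; `d_j = 1∕(g^B_{j+1})² − 1∕(g^A_j)²`,
`e_i = g^A_i − g^B_{i+1}`, `E_j = ρ(j+1)(g^B_{j+1} − g^B_0)`).  Generation 54 proved the source-free stretch by the ECHO COUNT and reduced the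
memory zone to two conditional frameworks whose a-priori inequalities mixed the unknown past gaps `S°_j = Σ_{i<j} ρ(j−i)e_i` with B's sources.  THIS
FILE removes the mixing.  At the current discrepancy `D = d_j` every past position `i < j` has its TRIAL GAP `t_i = g^A_i − 1∕√(1∕(g^A_i)² + D)`
(`0 ≤ t_i ≤ e_i` when the past dominates; `t_i ≤ ((g^A_i)³∕2)·D`), so `S°_j = W_j + Σ ρ(j−i)t_i` with the SURPLUS `W_j = Σ_{i<j} ρ(j−i)(e_i − t_i) ≥ 0`
and the step identity reads `d_j − d_{j+1} = E_j + W_j − X_j`, `X_j ≤ κ_j D` the cubic position excess (`…MemoryZoneCubic.excess_le_cubic_sum`).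
The SAME `W_j` controls the discrepancy from above: generation 54's dropped-pin window bound with the echo count gives
`D ≤ U_j + (K − j)S°_j + F_j ≤ U′_j + (K − j)(W_j + σ_j D) + Λ_j D∕(1 − Wγ∕b)` (`σ_j = ½Σρ(j−i)(g^A_i)³`; the future-in-memory feedback `F_j` priced by
`e_i ≤ ((g^A_i)³∕2)d_i` and generation 50's comparison `d_i ≤ d_j∕(1 − Wγ∕b)`), and B's source is traded for A's coupling,
`E_j = E′_j − ρ(j+1)e_j ≥ E′_j − ρ(j+1)((g^A_j)³∕2)D`.  Multiplying out, `Θ_j(d_j − d_{j+1}) ≥ (Θ_jE′_j − κ′_jU′_j) + W_j(Θ_j − (K − j)κ′_j)`: the surplus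
appears on both sides with a coefficient of the right sign as soon as `(K − j)κ′_j ≤ Θ_j`, and NO recursion over earlier decrements, no split of the
memory zone, no memory hypothesis is needed — only the two scalar inequalities, position by position.

WHAT IS PROVED ([folklore]; 0 sorry; 0 `def`).  §1 `trialGap_le_cube` (`g − 1∕√(1∕g² + D) ≤ (g³∕2)D`).  §2 **`disc_step_ge_of_forward`** (the step,
quantitative: dominating past + the first scalar inequality ⇒ `Θ_jE′ − (κ₂∕2)U′ ≤ Θ_j(d_j − d_{j+1})`), **`disc_succ_le_disc_of_forward`** (the step: dominating past + `Θ_j > 0` + the two scalar inequalities ⇒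
`d_{j+1} ≤ d_j`).  §3 **`disc_succ_le_disc_of_forward_all`** (the two scalar inequalities at every `1 ≤ j ≤ K − 2` ⇒ `d_{j+1} ≤ d_j` for EVERY `j < K`;
position `0` by B's extra source, position `K − 1` by the pin; strong induction supplies the dominating past), `disc_le_disc_of_succ_le`.
-/

noncomputable section

open Finset Filter Topology

namespace Summit.QuantumFields.BalabanUV.Beta.RemainderExplicitHistoryDiagonalForwardStep

open Literature.MathematicalPhysics.QuantumFieldTheory.Balaban1983to89
open Literature.MathematicalPhysics.QuantumFieldTheory.Balaban1983to89.FlowStep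
open Literature.MathematicalPhysics.QuantumFieldTheory.Balaban1983to89.T4CouplingMatching
open Literature.MathematicalPhysics.QuantumFieldTheory.Balaban1983to89.T4ContinuumCoupling
open Summit.QuantumFields.BalabanUV.Beta.RemainderExplicitHistoryDiagonalMonotone
open Summit.QuantumFields.BalabanUV.Beta.RemainderExplicitHistoryDiagonalWeights
open Summit.QuantumFields.BalabanUV.Beta.RemainderExplicitHistoryDiagonalTwoRun
open Summit.QuantumFields.BalabanUV.Beta.RemainderExplicitHistoryDiagonalWindow
open Summit.QuantumFields.BalabanUV.Beta.RemainderExplicitHistoryDiagonalOneStepMonotone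
open Summit.QuantumFields.BalabanUV.Beta.RemainderExplicitHistoryDiagonalEchoMonotone
open Summit.QuantumFields.BalabanUV.Beta.RemainderExplicitHistoryDiagonalMemoryZone
open Summit.QuantumFields.BalabanUV.Beta.RemainderExplicitHistoryDiagonalMemoryZoneCubic
open Summit.QuantumFields.BalabanUV.Beta.RemainderExplicitHistoryDiagonalComparison
open Summit.QuantumFields.BalabanUV.Beta.RemainderExplicitHistoryDiagonalRunEnvelope

variable {β : HBeta} {b γ W : ℝ} {ρ : ℕ → ℝ}

/-! ## §1 The trial gap is at most the cube times half the discrepancy -/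

/-- THE TRIAL GAP IS AT MOST THE CUBE TIMES HALF THE DISCREPANCY: for `g > 0`, `D ≥ 0`, `g − 1∕√(1∕g² + D) ≤ (g³∕2)·D`
(`…Weights.gap_le_cube_mul` at the trial coupling `1∕√(1∕g² + D)`, whose discrepancy from `g` is exactly `D`). [folklore] -/
theorem trialGap_le_cube {g D : ℝ} (hg : 0 < g) (hD : 0 ≤ D) : g - 1 / Real.sqrt (1 / g ^ 2 + D) ≤ g ^ 3 / 2 * D := by
  have hq : 0 < 1 / g ^ 2 + D := by positivity
  have hu : 0 < 1 / Real.sqrt (1 / g ^ 2 + D) := by positivity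
  have husq : 1 / (1 / Real.sqrt (1 / g ^ 2 + D)) ^ 2 = 1 / g ^ 2 + D := by
    rw [one_div_pow, Real.sq_sqrt hq.le, one_div_one_div]
  have hle : 1 / Real.sqrt (1 / g ^ 2 + D) ≤ g := by linarith [trialGap_nonneg hg hD]
  have h := gap_le_cube_mul hu hle
  rw [husq] at h
  have e : 1 / g ^ 2 + D - 1 / g ^ 2 = D := by ring
  rwa [e] at h

/-! ## §2 The forward step with the surplus matched against its own echo -/

/-- **THE FORWARD STEP, QUANTITATIVE FORM.**  Road P3's order-0 profile family in ]0,γ] (`b > 0`, `γ > 0`, `ρ ≥ 0` non-increasing on the positive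
ages, `Σ_{a<N} ρ(a) ≤ W`, `Wγ < b`); two runs — A: `K` steps in the box, B: `K + 1` steps, positive — pinned `g^A_K = g^B_{K+1}`; a position `j < K`
whose past dominates it (`d_j ≤ d_i` for `i < j`, `d_i = 1∕(g^B_{i+1})² − 1∕(g^A_i)²`).  With
`σ₂ = Σ_{i<j} ρ(j−i)(g^A_i)³`, `κ₂ = Σ_{i<j} ρ(j−i)((g^A_j)³ − (g^A_i)³) + ρ(j+1)(g^A_j)³`, `Λ₂ = Σ_{i∈[j,K)} (W − Σ_{a≤i} ρ(a))(g^A_i)³`,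
`U′ = Σ_{l∈[j,K)} ρ(l+1)(g^A_l − g^B_0)`, `E′ = ρ(j+1)(g^A_j − g^B_0)` and `Θ = 1 − (K−j)σ₂∕2 − Λ₂∕(2(1 − Wγ∕b))`: IF `(K − j)κ₂∕2 ≤ Θ` THEN
`Θ·E′ − (κ₂∕2)·U′ ≤ Θ·(d_j − d_{j+1})`.  (Step identity + trial gaps: `d_j − d_{j+1} ≥ E′ + W_j − (κ₂∕2)d_j`; dropped-pin window bound + echo count +
`…Comparison.disc_le_disc_div`: `Θ·d_j ≤ U′ + (K − j)W_j`; the surplus `W_j ≥ 0` of the past gaps over their trial gaps then carries the coefficient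
`Θ − (K − j)κ₂∕2 ≥ 0` and is dropped.) [cite: Balaban1987RG1, (0.20) p.256, (0.31) and Thm 2 p.259] -/
theorem disc_step_ge_of_forward
    (hβ : ∀ (k : ℕ) (p : Fin (k + 1) → ℝ),
      β k p = b + ∑ i : Fin (k + 1), ρ (k - i) * min (p (Fin.last k)) (|p (Fin.last k) - p i|))
    (hb : 0 < b) (hγ : 0 < γ) (hρ0 : ∀ a, 0 ≤ ρ a) (hρW : ∀ n, ∑ a ∈ range n, ρ a ≤ W) (hmono : ∀ a, 1 ≤ a → ρ (a + 1) ≤ ρ a)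
    (hWγ : W * γ < b) {K : ℕ} {gA gB : ℕ → ℝ} (hA : RGEqH K β gA) (hB : RGEqH (K + 1) β gB)
    (hAbox : ∀ k, k ≤ K → 0 < gA k ∧ gA k ≤ γ) (hBpos : ∀ k, k ≤ K + 1 → 0 < gB k) (hpin : gA K = gB (K + 1)) {j : ℕ} (hj : j < K)
    (hdomPast : ∀ i, i < j → 1 / (gB (j + 1)) ^ 2 - 1 / (gA j) ^ 2 ≤ 1 / (gB (i + 1)) ^ 2 - 1 / (gA i) ^ 2)
    (h1 : ((K - j : ℕ) : ℝ) * ((∑ i ∈ range j, ρ (j - i) * ((gA j) ^ 3 - (gA i) ^ 3)) + ρ (j + 1) * (gA j) ^ 3) / 2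
        ≤ 1 - ((K - j : ℕ) : ℝ) * (∑ i ∈ range j, ρ (j - i) * (gA i) ^ 3) / 2
          - (∑ i ∈ Ico j K, (W - ∑ a ∈ range (i + 1), ρ a) * (gA i) ^ 3) / (2 * (1 - W * γ / b))) :
    (1 - ((K - j : ℕ) : ℝ) * (∑ i ∈ range j, ρ (j - i) * (gA i) ^ 3) / 2
        - (∑ i ∈ Ico j K, (W - ∑ a ∈ range (i + 1), ρ a) * (gA i) ^ 3) / (2 * (1 - W * γ / b)))
        * (ρ (j + 1) * (gA j - gB 0))
      - ((∑ i ∈ range j, ρ (j - i) * ((gA j) ^ 3 - (gA i) ^ 3)) + ρ (j + 1) * (gA j) ^ 3) / 2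
        * ∑ l ∈ Ico j K, ρ (l + 1) * (gA l - gB 0)
      ≤ (1 - ((K - j : ℕ) : ℝ) * (∑ i ∈ range j, ρ (j - i) * (gA i) ^ 3) / 2
          - (∑ i ∈ Ico j K, (W - ∑ a ∈ range (i + 1), ρ a) * (gA i) ^ 3) / (2 * (1 - W * γ / b)))
        * ((1 / (gB (j + 1)) ^ 2 - 1 / (gA j) ^ 2) - (1 / (gB (j + 1 + 1)) ^ 2 - 1 / (gA (j + 1)) ^ 2)) := by
  have hApos : ∀ k, k ≤ K → 0 < gA k := fun k hk => (hAbox k hk).1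
  have hdom := invSq_le_invSq_shift_run hβ hb hρ0 hA hB hApos hBpos hpin
  have hBA : ∀ i, i ≤ K → gB (i + 1) ≤ gA i := fun i hi =>
    le_of_one_div_sq_le (hApos i hi) (hBpos (i + 1) (by omega)) (hdom i hi)
  have hc : 0 < 1 - W * γ / b := by
    have : W * γ / b < 1 := (div_lt_one hb).mpr hWγ
    linarith
  have hW : 0 ≤ W := by simpa using hρW 0
  -- names for the recurring quantities
  set D : ℝ := 1 / (gB (j + 1)) ^ 2 - 1 / (gA j) ^ 2 with hD
  set σ₂ : ℝ := ∑ i ∈ range j, ρ (j - i) * (gA i) ^ 3 with hσ₂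
  set κ₂ : ℝ := (∑ i ∈ range j, ρ (j - i) * ((gA j) ^ 3 - (gA i) ^ 3)) + ρ (j + 1) * (gA j) ^ 3 with hκ₂
  set Λ₂ : ℝ := ∑ i ∈ Ico j K, (W - ∑ a ∈ range (i + 1), ρ a) * (gA i) ^ 3 with hΛ₂
  set U' : ℝ := ∑ l ∈ Ico j K, ρ (l + 1) * (gA l - gB 0) with hU'
  set E' : ℝ := ρ (j + 1) * (gA j - gB 0) with hE'
  set Θ : ℝ := 1 - ((K - j : ℕ) : ℝ) * σ₂ / 2 - Λ₂ / (2 * (1 - W * γ / b)) with hΘdef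
  have hD0 : 0 ≤ D := by have := hdom j hj.le; simp only [hD]; linarith
  have hgj := hApos j hj.le
  -- trial gaps of the past at the current discrepancy
  set t : ℕ → ℝ := fun i => gA i - 1 / Real.sqrt (1 / (gA i) ^ 2 + D) with ht
  have ht_le : ∀ i, i < j → t i ≤ gA i - gB (i + 1) := fun i hi =>
    trialGap_le_gap (hApos i (by omega)) (hBpos (i + 1) (by omega)) hD0 (hdomPast i hi)
  have ht0 : ∀ i, i < j → 0 ≤ t i := fun i hi => trialGap_nonneg (hApos i (by omega)) hD0
  have ht_cube : ∀ i, i < j → t i ≤ (gA i) ^ 3 / 2 * D := fun i hi => trialGap_le_cube (hApos i (by omega)) hD0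
  -- the surplus of the past gaps over their trial gaps
  set Wp : ℝ := ∑ i ∈ range j, ρ (j - i) * ((gA i - gB (i + 1)) - t i) with hWp
  have hWp0 : 0 ≤ Wp := Finset.sum_nonneg fun i hi =>
    mul_nonneg (hρ0 _) (by linarith [ht_le i (Finset.mem_range.mp hi)])
  -- the cubic position excess
  have hX : ∑ i ∈ range j, ρ (j - i) * ((gA j - gB (j + 1)) - t i)
      ≤ D / 2 * ∑ i ∈ range j, ρ (j - i) * ((gA j) ^ 3 - (gA i) ^ 3) :=
    excess_le_cubic_sum hρ0 (n := 1) (fun i hi => hApos i (by omega))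
      (fun i hi => run_mono_orderZero hβ hb hρ0 hA hApos hi hj.le) (hBpos (j + 1) (by omega)) hD0
  -- the current gap is at most the cube times half the discrepancy
  have hej : gA j - gB (j + 1) ≤ (gA j) ^ 3 / 2 * D := gap_le_cube_mul (hBpos (j + 1) (by omega)) (hBA j hj.le)
  have hejρ := mul_le_mul_of_nonneg_left hej (hρ0 (j + 1))
  -- (1) THE STEP IDENTITY, lower side: `δ ≥ E′ + Wp − (κ₂∕2)·D`
  have hstep := disc_step_window hβ hb hρ0 hA hB hApos hBpos hj
  rw [Finset.sum_range_one, Finset.sum_range_succ, Nat.sub_self] at hstep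
  have hsplit : ∑ i ∈ range j, ρ (j - i) * ((gA i - gB (i + 1)) - (gA j - gB (j + 1)))
      = Wp - ∑ i ∈ range j, ρ (j - i) * ((gA j - gB (j + 1)) - t i) := by
    rw [hWp, ← Finset.sum_sub_distrib]
    exact Finset.sum_congr rfl fun i _ => by ring
  have hlow : E' + Wp - κ₂ / 2 * D
      ≤ D - (1 / (gB (j + 1 + 1)) ^ 2 - 1 / (gA (j + 1)) ^ 2) := by
    rw [Nat.sub_zero, sub_self (gA j - gB (j + 1)), mul_zero, add_zero, hsplit] at hstep
    linear_combination hejρ + hX + hE' - (D / 2) * hκ₂ - hstep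
  -- (2) THE WINDOW BOUND, upper side: `Θ·D ≤ U′ + (K − j)·Wp`
  have hdrop := disc_le_dropped_echo hβ hb hρ0 hmono hA hB hApos hBpos hpin hj.le (N := K) le_rfl
  -- B's sources are at most A's
  have hU : ∑ l ∈ Ico j K, ∑ i ∈ range 1, ρ (l + 1 - i) * (gB (l + 1) - gB i) ≤ U' := by
    rw [hU']
    refine Finset.sum_le_sum fun l hl => ?_
    have hl' := (Finset.mem_Ico.mp hl).2
    rw [Finset.sum_range_one, Nat.sub_zero]
    exact mul_le_mul_of_nonneg_left (by linarith [hBA l hl'.le]) (hρ0 _)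
  -- the past's gaps: surplus plus trial gaps
  have hS : ∑ i ∈ range j, ρ (j - i) * (gA i - gB (i + 1)) ≤ Wp + σ₂ / 2 * D := by
    have e : ∑ i ∈ range j, ρ (j - i) * (gA i - gB (i + 1)) = Wp + ∑ i ∈ range j, ρ (j - i) * t i := by
      rw [hWp, ← Finset.sum_add_distrib]; exact Finset.sum_congr rfl fun i _ => by ring
    have h3 : ∑ i ∈ range j, ρ (j - i) * t i ≤ ∑ i ∈ range j, ρ (j - i) * ((gA i) ^ 3 / 2 * D) :=
      Finset.sum_le_sum fun i hi => mul_le_mul_of_nonneg_left (ht_cube i (Finset.mem_range.mp hi)) (hρ0 (j - i))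
    have e2 : ∑ i ∈ range j, ρ (j - i) * ((gA i) ^ 3 / 2 * D) = σ₂ / 2 * D := by
      rw [hσ₂, Finset.sum_div, Finset.sum_mul]; exact Finset.sum_congr rfl fun i _ => by ring
    linarith
  -- the future-in-memory feedback: conversion weight, tail mass, comparison along the run
  have hF : ∑ i ∈ Ico j K, (gA i - gB (i + 1)) * (∑ a ∈ range K, ρ a - ∑ a ∈ range (i + 1), ρ a)
      ≤ Λ₂ / 2 * (D / (1 - W * γ / b)) := by
    rw [hΛ₂, Finset.sum_div, Finset.sum_mul]
    refine Finset.sum_le_sum fun i hi => ?_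
    have hi' := Finset.mem_Ico.mp hi
    have hei0 : 0 ≤ gA i - gB (i + 1) := by linarith [hBA i hi'.2.le]
    have hei : gA i - gB (i + 1) ≤ (gA i) ^ 3 / 2 * (1 / (gB (i + 1)) ^ 2 - 1 / (gA i) ^ 2) :=
      gap_le_cube_mul (hBpos (i + 1) (by omega)) (hBA i hi'.2.le)
    have hdi : 1 / (gB (i + 1)) ^ 2 - 1 / (gA i) ^ 2 ≤ D / (1 - W * γ / b) :=
      disc_le_disc_div hβ hb hγ hρ0 hρW hWγ hA hB hAbox hBpos hpin hi'.1 hi'.2.le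
    have hR0 : 0 ≤ ∑ a ∈ range K, ρ a - ∑ a ∈ range (i + 1), ρ a := by
      linarith [partialSum_mono hρ0 (show i + 1 ≤ K by omega)]
    have hRW : ∑ a ∈ range K, ρ a - ∑ a ∈ range (i + 1), ρ a ≤ W - ∑ a ∈ range (i + 1), ρ a := by
      linarith [hρW K]
    have hg3 : 0 ≤ (gA i) ^ 3 / 2 := by have := hApos i hi'.2.le; positivity
    calc (gA i - gB (i + 1)) * (∑ a ∈ range K, ρ a - ∑ a ∈ range (i + 1), ρ a)
        ≤ ((gA i) ^ 3 / 2 * (D / (1 - W * γ / b))) * (W - ∑ a ∈ range (i + 1), ρ a) :=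
          mul_le_mul (hei.trans (mul_le_mul_of_nonneg_left hdi hg3)) hRW hR0 (mul_nonneg hg3 (div_nonneg hD0 hc.le))
      _ = (W - ∑ a ∈ range (i + 1), ρ a) * (gA i) ^ 3 / 2 * (D / (1 - W * γ / b)) := by ring
  have hup : Θ * D ≤ U' + ((K - j : ℕ) : ℝ) * Wp := by
    have hKj : 0 ≤ ((K - j : ℕ) : ℝ) := Nat.cast_nonneg _
    have hmid := mul_le_mul_of_nonneg_left hS hKj
    have e : Λ₂ / 2 * (D / (1 - W * γ / b)) = Λ₂ / (2 * (1 - W * γ / b)) * D := by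
      rw [div_mul_div_comm, div_mul_eq_mul_div]
    have h3 := hF.trans_eq e
    rw [hΘdef]
    linear_combination hdrop + hU + hmid + h3
  -- (3) combine: `Θ·δ ≥ (ΘE′ − (κ₂∕2)U′) + Wp(Θ − (K−j)κ₂∕2) ≥ 0`
  have hκ0 : 0 ≤ κ₂ := by
    rw [hκ₂]
    refine add_nonneg (Finset.sum_nonneg fun i hi => mul_nonneg (hρ0 _) ?_) (mul_nonneg (hρ0 _) (pow_pos hgj 3).le)
    have hi' := Finset.mem_range.mp hi
    have hle := run_mono_orderZero hβ hb hρ0 hA hApos hi'.le hj.le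
    nlinarith [pow_le_pow_left₀ (hApos i (by omega)).le hle 3]
  have hΘ0 : 0 ≤ Θ := le_trans (div_nonneg (mul_nonneg (Nat.cast_nonneg _) hκ0) (by norm_num)) h1
  have a1 := mul_le_mul_of_nonneg_left hlow hΘ0
  have a2 := mul_le_mul_of_nonneg_left hup (by positivity : 0 ≤ κ₂ / 2)
  have a3 : 0 ≤ Wp * (Θ - ((K - j : ℕ) : ℝ) * κ₂ / 2) := mul_nonneg hWp0 (by linarith [h1])
  show Θ * E' - κ₂ / 2 * U' ≤ Θ * (D - (1 / (gB (j + 1 + 1)) ^ 2 - 1 / (gA (j + 1)) ^ 2))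
  linear_combination a1 + a2 + a3

/-- **THE FORWARD STEP.**  Same setting; IF moreover `Θ > 0` and `(κ₂∕2)·U′ ≤ Θ·E′`, THEN `d_{j+1} ≤ d_j`. [cite: Balaban1987RG1, (0.20) p.256, (0.31) and Thm 2 p.259] -/
theorem disc_succ_le_disc_of_forward
    (hβ : ∀ (k : ℕ) (p : Fin (k + 1) → ℝ),
      β k p = b + ∑ i : Fin (k + 1), ρ (k - i) * min (p (Fin.last k)) (|p (Fin.last k) - p i|))
    (hb : 0 < b) (hγ : 0 < γ) (hρ0 : ∀ a, 0 ≤ ρ a) (hρW : ∀ n, ∑ a ∈ range n, ρ a ≤ W) (hmono : ∀ a, 1 ≤ a → ρ (a + 1) ≤ ρ a)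
    (hWγ : W * γ < b) {K : ℕ} {gA gB : ℕ → ℝ} (hA : RGEqH K β gA) (hB : RGEqH (K + 1) β gB)
    (hAbox : ∀ k, k ≤ K → 0 < gA k ∧ gA k ≤ γ) (hBpos : ∀ k, k ≤ K + 1 → 0 < gB k) (hpin : gA K = gB (K + 1)) {j : ℕ} (hj : j < K)
    (hdomPast : ∀ i, i < j → 1 / (gB (j + 1)) ^ 2 - 1 / (gA j) ^ 2 ≤ 1 / (gB (i + 1)) ^ 2 - 1 / (gA i) ^ 2)
    (hΘ : 0 < 1 - ((K - j : ℕ) : ℝ) * (∑ i ∈ range j, ρ (j - i) * (gA i) ^ 3) / 2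
        - (∑ i ∈ Ico j K, (W - ∑ a ∈ range (i + 1), ρ a) * (gA i) ^ 3) / (2 * (1 - W * γ / b)))
    (h1 : ((K - j : ℕ) : ℝ) * ((∑ i ∈ range j, ρ (j - i) * ((gA j) ^ 3 - (gA i) ^ 3)) + ρ (j + 1) * (gA j) ^ 3) / 2
        ≤ 1 - ((K - j : ℕ) : ℝ) * (∑ i ∈ range j, ρ (j - i) * (gA i) ^ 3) / 2
          - (∑ i ∈ Ico j K, (W - ∑ a ∈ range (i + 1), ρ a) * (gA i) ^ 3) / (2 * (1 - W * γ / b)))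
    (h2 : ((∑ i ∈ range j, ρ (j - i) * ((gA j) ^ 3 - (gA i) ^ 3)) + ρ (j + 1) * (gA j) ^ 3) / 2
          * ∑ l ∈ Ico j K, ρ (l + 1) * (gA l - gB 0)
        ≤ (1 - ((K - j : ℕ) : ℝ) * (∑ i ∈ range j, ρ (j - i) * (gA i) ^ 3) / 2
            - (∑ i ∈ Ico j K, (W - ∑ a ∈ range (i + 1), ρ a) * (gA i) ^ 3) / (2 * (1 - W * γ / b)))
          * (ρ (j + 1) * (gA j - gB 0))) :
    1 / (gB (j + 1 + 1)) ^ 2 - 1 / (gA (j + 1)) ^ 2 ≤ 1 / (gB (j + 1)) ^ 2 - 1 / (gA j) ^ 2 := by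
  have h := disc_step_ge_of_forward hβ hb hγ hρ0 hρW hmono hWγ hA hB hAbox hBpos hpin hj hdomPast h1
  have hfin : 0 ≤ (1 - ((K - j : ℕ) : ℝ) * (∑ i ∈ range j, ρ (j - i) * (gA i) ^ 3) / 2
      - (∑ i ∈ Ico j K, (W - ∑ a ∈ range (i + 1), ρ a) * (gA i) ^ 3) / (2 * (1 - W * γ / b)))
      * ((1 / (gB (j + 1)) ^ 2 - 1 / (gA j) ^ 2) - (1 / (gB (j + 1 + 1)) ^ 2 - 1 / (gA (j + 1)) ^ 2)) := by
    linarith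
  have hres := (mul_nonneg_iff_of_pos_left hΘ).mp hfin
  linarith

/-! ## §3 One forward induction over the whole run -/

/-- **ONE FORWARD INDUCTION.**  Same two pinned runs (A: `K` steps in ]0,γ], B: `K + 1` steps; profile non-increasing on the positive ages,
`Σ_{a<N} ρ(a) ≤ W`, `Wγ < b`).  IF at every position `1 ≤ j ≤ K − 2` the quantity `Θ_j` of `disc_succ_le_disc_of_forward` is positive and the two scalar
inequalities `(K − j)κ₂∕2 ≤ Θ_j`, `(κ₂∕2)·U′_j ≤ Θ_j·E′_j` hold, THEN `d_{j+1} ≤ d_j` for EVERY `j < K`: position `0` by B's extra source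
(`…OneStepMonotone.disc_step_zero`), positions `1 ≤ j ≤ K − 2` by the forward step — the dominating past being the induction hypothesis — and
position `K − 1` by the pin (`d_K = 0 ≤ d_{K−1}`).  No memory hypothesis, no split of the run. [cite: Balaban1987RG1, (0.20) p.256, (0.31) and Thm 2 p.259] -/
theorem disc_succ_le_disc_of_forward_all
    (hβ : ∀ (k : ℕ) (p : Fin (k + 1) → ℝ),
      β k p = b + ∑ i : Fin (k + 1), ρ (k - i) * min (p (Fin.last k)) (|p (Fin.last k) - p i|))
    (hb : 0 < b) (hγ : 0 < γ) (hρ0 : ∀ a, 0 ≤ ρ a) (hρW : ∀ n, ∑ a ∈ range n, ρ a ≤ W) (hmono : ∀ a, 1 ≤ a → ρ (a + 1) ≤ ρ a)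
    (hWγ : W * γ < b) {K : ℕ} {gA gB : ℕ → ℝ} (hA : RGEqH K β gA) (hB : RGEqH (K + 1) β gB)
    (hAbox : ∀ k, k ≤ K → 0 < gA k ∧ gA k ≤ γ) (hBpos : ∀ k, k ≤ K + 1 → 0 < gB k) (hpin : gA K = gB (K + 1))
    (hcrit : ∀ j, 1 ≤ j → j + 2 ≤ K →
      (0 < 1 - ((K - j : ℕ) : ℝ) * (∑ i ∈ range j, ρ (j - i) * (gA i) ^ 3) / 2
          - (∑ i ∈ Ico j K, (W - ∑ a ∈ range (i + 1), ρ a) * (gA i) ^ 3) / (2 * (1 - W * γ / b))) ∧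
      (((K - j : ℕ) : ℝ) * ((∑ i ∈ range j, ρ (j - i) * ((gA j) ^ 3 - (gA i) ^ 3)) + ρ (j + 1) * (gA j) ^ 3) / 2
          ≤ 1 - ((K - j : ℕ) : ℝ) * (∑ i ∈ range j, ρ (j - i) * (gA i) ^ 3) / 2
            - (∑ i ∈ Ico j K, (W - ∑ a ∈ range (i + 1), ρ a) * (gA i) ^ 3) / (2 * (1 - W * γ / b))) ∧
      (((∑ i ∈ range j, ρ (j - i) * ((gA j) ^ 3 - (gA i) ^ 3)) + ρ (j + 1) * (gA j) ^ 3) / 2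
            * ∑ l ∈ Ico j K, ρ (l + 1) * (gA l - gB 0)
          ≤ (1 - ((K - j : ℕ) : ℝ) * (∑ i ∈ range j, ρ (j - i) * (gA i) ^ 3) / 2
              - (∑ i ∈ Ico j K, (W - ∑ a ∈ range (i + 1), ρ a) * (gA i) ^ 3) / (2 * (1 - W * γ / b)))
            * (ρ (j + 1) * (gA j - gB 0)))) :
    ∀ j, j < K → 1 / (gB (j + 1 + 1)) ^ 2 - 1 / (gA (j + 1)) ^ 2 ≤ 1 / (gB (j + 1)) ^ 2 - 1 / (gA j) ^ 2 := by
  have hApos : ∀ k, k ≤ K → 0 < gA k := fun k hk => (hAbox k hk).1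
  have hdom := invSq_le_invSq_shift_run hβ hb hρ0 hA hB hApos hBpos hpin
  set d : ℕ → ℝ := fun j => 1 / (gB (j + 1)) ^ 2 - 1 / (gA j) ^ 2 with hd
  suffices hmain : ∀ j, j < K → ∀ i, i ≤ j → d (i + 1) ≤ d i by
    intro j hj
    exact hmain j hj j le_rfl
  intro j
  induction j with
  | zero =>
    intro hK i hi
    have hi0 : i = 0 := by omega
    subst hi0
    have h0 := disc_step_zero hβ hb hρ0 hA hB hApos hBpos hK
    have hE := extra_nonneg hβ hb hρ0 hB hBpos (j := 0) (Nat.zero_le K)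
    simp only [Nat.zero_add] at h0 hE
    show 1 / (gB (0 + 1 + 1)) ^ 2 - 1 / (gA (0 + 1)) ^ 2 ≤ 1 / (gB (0 + 1)) ^ 2 - 1 / (gA 0) ^ 2
    simp only [Nat.zero_add]
    linarith
  | succ j ih =>
    intro hjK i hi
    rcases Nat.lt_or_ge i (j + 1) with hij | hij
    · exact ih (by omega) i (by omega)
    · have hieq : i = j + 1 := by omega
      subst hieq
      have ih' := ih (by omega)
      by_cases hlast : j + 1 + 2 ≤ K
      · -- the past dominates position `j + 1`: chain the one-step comparisons of the induction hypothesis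
        have hchain : ∀ t, t ≤ j + 1 → d (j + 1) ≤ d (j + 1 - t) := by
          intro t
          induction t with
          | zero => intro _; simp
          | succ t iht =>
            intro ht
            have h1 := iht (by omega)
            have h2 := ih' (j - t) (by omega)
            rw [show j - t + 1 = j + 1 - t by omega] at h2
            rw [show j + 1 - (t + 1) = j - t by omega]
            exact h1.trans h2
        have hdomPast : ∀ i, i < j + 1 → d (j + 1) ≤ d i := by
          intro i hi
          have := hchain (j + 1 - i) (by omega)
          rwa [show j + 1 - (j + 1 - i) = i by omega] at this
        obtain ⟨hΘ, h1, h2⟩ := hcrit (j + 1) (by omega) hlast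
        exact disc_succ_le_disc_of_forward hβ hb hγ hρ0 hρW hmono hWγ hA hB hAbox hBpos hpin (j := j + 1) hjK
          (fun i hi => by simpa [hd] using hdomPast i hi) hΘ h1 h2
      · -- the last step: `d_K = 0 ≤ d_{K−1}`
        have hK : j + 1 + 1 = K := by omega
        show 1 / (gB (j + 1 + 1 + 1)) ^ 2 - 1 / (gA (j + 1 + 1)) ^ 2 ≤ 1 / (gB (j + 1 + 1)) ^ 2 - 1 / (gA (j + 1)) ^ 2
        have hdj := hdom (j + 1) (by omega)
        rw [hK] at hdj ⊢
        rw [hpin, sub_self]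
        linarith

/-- MONOTONE AT EVERY STEP ⇒ THE PAST DOMINATES EVERY POSITION: from `d_{l+1} ≤ d_l` for all `l < K`, `d_j ≤ d_i` whenever `i ≤ j ≤ K`
(`d_l = 1∕(g^B_{l+1})² − 1∕(g^A_l)²`). [folklore] -/
theorem disc_le_disc_of_succ_le {K : ℕ} {gA gB : ℕ → ℝ}
    (h : ∀ l, l < K → 1 / (gB (l + 1 + 1)) ^ 2 - 1 / (gA (l + 1)) ^ 2 ≤ 1 / (gB (l + 1)) ^ 2 - 1 / (gA l) ^ 2)
    {i j : ℕ} (hij : i ≤ j) (hj : j ≤ K) :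
    1 / (gB (j + 1)) ^ 2 - 1 / (gA j) ^ 2 ≤ 1 / (gB (i + 1)) ^ 2 - 1 / (gA i) ^ 2 := by
  induction j, hij using Nat.le_induction with
  | base => exact le_rfl
  | succ j hij ih => exact (h j (by omega)).trans (ih (by omega))

end Summit.QuantumFields.BalabanUV.Beta.RemainderExplicitHistoryDiagonalForwardStep
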